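import Summits.BirchSwinnertonDyer.BirchSwinnertonDyer.Theorems.ByReductionTypeAtTwoSupersingularFlatLiftAssemblyTop
import Summits.BirchSwinnertonDyer.BirchSwinnertonDyer.Theorems.ByReductionTypeAtTwoSupersingularFlatLiftAssembly
import Summits.BirchSwinnertonDyer.BirchSwinnertonDyer.Theorems.ByReductionTypeAtTwoSupersingularFlatKerGCount
import Summits.BirchSwinnertonDyer.BirchSwinnertonDyer.Theorems.ByReductionTypeAtTwoSupersingularFlatEvalMapCount
import Literature.NumberTheory.EllipticCurves.Sprung2024.ChromaticSmallControlSurjProofs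
import Literature.NumberTheory.EllipticCurves.SelmerCorankControlRatLevelZeroProofs
import Literature.NumberTheory.GaloisRepresentations.PadicAlgebraDegreeOnePlace
import Literature.NumberTheory.EllipticCurves.Greenberg1999.CasselsSurjectivityH1Sigma
import HarnessLib

/-!
# CASSELS' COUNT `#ker g♭ = p^{ord_p ∏ c_ℓ}` from Cassels' theorem (Greenberg, LNM 1716 p. 104: «by
# Cassels' theorem, `ker(g) = ker(r)`») — the EQUALITY half of COUNT♭, reduced to the printed surjectivity
# (Prop. 4.13 / p. 122, tree named fact `Greenberg1999.casselsSurjectivity_H1Sigma`) + kernel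

Seat `bsd-2adic-ss-1` GEN 12, crux `SupersingularRankZeroAtTwo` (item stmt-BirchSwinnertonDyer-19097, route
`ByReductionTypeAtTwo`, rung K4), line `flat_uniform_two` v1, stub (2) `stub_allFlatData`, conjunct
COUNT♭@2 — part 8 of the series. GEN 11's part 2 unpacked COUNT♭ into Cassels' COUNT `#(A♭_0/Sel_0) =
p^{ord_p ∏ c_ℓ}` and COINV♭; parts 4–7 (this GEN) reduced COINV♭ to PRINT + local lifts. This file does
the same for Cassels' count: part 1 (GEN 11) proved `∣` through the K3 lane's evaluation map
`Φ : A♭_0 → ∏_{w ∈ S} 𝒦_{w,0}[p^∞]` with `ker Φ ⊆ Sel_0`; EQUALITY is the SURJECTIVITY of `Φ`, and that is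
Cassels' theorem at level `K` (Greenberg p. 104: «`ker(g) = ker(r) ∩ 𝒢_E^Σ(F)` … by Cassels' theorem,
`ker(g) = ker(r)`», i.e. `𝒢^Σ(F) = 𝒫^Σ(F)` when `E(F)_p = 0`): a family `(k_w)_w` of layer-`0` local
classes dying in the tower IS the localisation of a global class `y ∈ H¹(K_Σ/K, E[p^∞])` with `loc_p y = 0`,
`loc_∞ y = 0`; such a `y` lies in `A♭_0 = h_0⁻¹(Sel♭_∞)` (at `p`: a layer-`0` Kummer class restricts into
`E♭` — the K3 lane's `layerToInfty_mem_sharpFlatLocalKummerOverOfEmb_of_mem_localKerOver`, given «`Ker Col♭`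
kills `E(K_p)`»; off `Σ`: unramified ⇒ Kummer over the cyclotomic tower; at `∞`: `r_w(0) = 0`).

WHAT IS PROVED (namespace `…Theorems.SSFlatEC`; the generic §1 «`Φ` onto ⇒ `#(A'/Sel_0) = ∏ #𝒦`» is
part 8a, `…FlatEvalMapCount.lean`, `natCard_quotient_selmerLayer_zero_eq_prod_of_forall_exists`):
* §2 (`K = ℚ`, any `p`, CYCLOTOMIC `κ`, the place `v ∋ p`, `•`-data `(g, c)` with «`Ker Col^•` kills
  `E(ℚ_p)`» in the K3 shape) `forall_exists_mem_flatPreimage_localResOver_eq_of_cassels` — CASSELS at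
  level `Γ_ℚ` (the body of `Greenberg1999.casselsSurjectivity_H1Sigma ℚ`, displayed) ⇒ the surjectivity
  hypothesis of §1 for `A♭_0`; `natCard_flatKerG_eq_pow_of_cassels` — hence
  **`#(A♭_0/Sel_0) = p^{ord_p ∏_v c_v}`** (Greenberg p. 88 count, tree; good reduction at `p`).
* §3 `natCard_flatKerG_eq_pow_of_casselsSurjectivity` — the same with CASSELS supplied BY NAME from the
  Literature fact `Greenberg1999.casselsSurjectivity_H1Sigma ℚ` under its printed hypotheses
  `Sel_{p^∞}(E/ℚ)` finite ∧ `E(ℚ)[p^∞] = 0`.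
So after this file the Cassels-count member of COUNT♭@2 reads PRINT-by-name {Greenberg Prop. 4.13 /
Cassels 1964} + THEOREM; the only displayed inputs left are the `•`-clause «`Ker Col^•` kills `E(ℚ_p)`»
(derived from the Honda clauses on the line) and finiteness of `Sel`. HONEST FRAMING: kernel theorems about
the tree's objects; nothing about any curve is asserted; no census cell moves; BSD is not proved by any of
this.

References: [GreenbergLNM1716] §3 Lemma 3.3 and p. 88; §4 p. 104 («by Cassels' theorem, ker(g) = ker(r)»),
Lemma 4.7 (p. 107), Prop. 4.13 and p. 122; [Sprung2024] §5.2 Lemma 5.5 (p. 40); [Cassels1964ArithmeticVII].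
-/

set_option autoImplicit false
-- the Theorems namespace of this sub repeats the summit name by design (D-0017 nested layout)
set_option linter.dupNamespace false

noncomputable section

open scoped Classical NumberField

open NumberField IsDedekindDomain

universe u

namespace Summit.BirchSwinnertonDyer.BirchSwinnertonDyer.Theorems.SSFlatEC

open Literature.NumberTheory.EllipticCurves Literature.NumberTheory.GaloisRepresentations
  WeierstrassCurve ZpExtension Literature.NumberTheory.EllipticCurves.Kobayashi2003
  Literature.NumberTheory.EllipticCurves.Sprung2017 Literature.NumberTheory.EllipticCurves.Sprung2012
  Literature.NumberTheory.EllipticCurves.Sprung2024 Literature.NumberTheory.EllipticCurves.IwasawaDual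
  Literature.NumberTheory.EllipticCurves.GreenbergVatsal2000
  Literature.NumberTheory.EllipticCurves.Rank1Residual Summit.BirchSwinnertonDyer.Rank1Residual.X5.O1
  Summit.BirchSwinnertonDyer.Rank1Residual.X2

/-! ## §2 Over `ℚ`: the surjectivity for `A^•_0` from CASSELS at level `Γ_ℚ` -/

/-- `ord_p` of a finite product of non-zero naturals is the sum of the `ord_p`'s (`padicValNat.mul`).
[folklore] -/
theorem padicValNat_finset_prod {ι : Type*} {q : ℕ} [Fact q.Prime] (s : Finset ι) (f : ι → ℕ)
    (hf : ∀ i ∈ s, f i ≠ 0) : padicValNat q (∏ i ∈ s, f i) = ∑ i ∈ s, padicValNat q (f i) := by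
  induction s using Finset.induction_on with
  | empty => simp
  | insert a s ha ih =>
    rw [Finset.prod_insert ha, Finset.sum_insert ha,
      padicValNat.mul (hf a (Finset.mem_insert_self a s))
        (Finset.prod_ne_zero_iff.mpr fun i hi ↦ hf i (Finset.mem_insert_of_mem hi)),
      ih fun i hi ↦ hf i (Finset.mem_insert_of_mem hi)]

section Rat

variable (W : WeierstrassCurve ℚ) [W.IsElliptic] {p : ℕ} [Fact p.Prime] (κ : ZpExtension ℚ p)
  {v : HeightOneSpectrum (𝓞 ℚ)} (ap : ℤ) (g : Field.absoluteGaloisGroup (v.adicCompletion ℚ))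
  (c : ℕ → localPoints W (v.adicCompletion ℚ)) (col : Chroma)

/-- Every `τ ∈ Γ_E` restricts into `κ⁻¹(p⁰ℤ_p) = Γ_K`: the local subgroup of `⊤` lies in that of the
`0`-th layer (and conversely — they are equal). [folklore] -/
theorem localSubgroup_top_le_layer_zero {K : Type u} [Field K] {q : ℕ} [Fact q.Prime] (κ' : ZpExtension K q)
    (E : Type u) [Field E] [Algebra K E] :
    localSubgroup (⊤ : Subgroup (Field.absoluteGaloisGroup K)) E ≤ localSubgroup (κ'.layerSubgroup 0) E :=
  fun τ _ ↦ (mem_localSubgroup_iff _ _ τ).mpr (by rw [ZpExtension.layerSubgroup_zero]; trivial)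

/-- **CASSELS at level `Γ_ℚ` ⇒ the evaluation map of `A^•_0` is onto** (`K = ℚ`, any `p`, CYCLOTOMIC `κ`,
the place `v ∋ p` with its `•`-data, «`Ker Col^•` kills `E(ℚ_p)`» in the K3 shape, `S ⊇` the bad places
prime to `p` with `p ∉ S`). Given `(k_w)_{w∈S}`, `k_w ∈ 𝒦_{w,0}[p^∞]`: CASSELS (the body of
`Greenberg1999.casselsSurjectivity_H1Sigma ℚ`) produces `y ∈ H¹(ℚ_Σ/ℚ, E[p^∞])` with `loc_w y = k_w` on `S`,
`loc_p y = 0`, `loc_∞ y = 0`; its restriction `y₀` to the `0`-th layer has `loc_w y₀ = k_w` and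
`h_0 y₀ ∈ Sel^•(E/ℚ_∞)`: at `w ∈ S`, `loc_w(h_0 y₀) = r_w k_w = 0`; off `Σ`, unramified ⇒ Kummer over
`ℚ_∞^{cyc}`; at `∞`, `0`; at `p`, a layer-`0` Kummer class restricts into `E^•`
(`layerToInfty_mem_sharpFlatLocalKummerOverOfEmb_of_mem_localKerOver`). [cite: GreenbergLNM1716, §4 p. 104
(«by Cassels' theorem, ker(g) = ker(r)») and p. 122] -/
theorem forall_exists_mem_flatPreimage_localResOver_eq_of_cassels (hκ : κ.IsCyclotomic)
    (hv : (p : 𝓞 ℚ) ∈ v.asIdeal)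
    (h𝒦 : ∀ z ∈ colemanKer κ (closureEmb (K := ℚ) (v.adicCompletion ℚ)) W ap g c col,
      ∀ (x : localPoints W (v.adicCompletion ℚ))
        (hx : x ∈ localLayerPointsOfEmb κ (closureEmb (K := ℚ) (v.adicCompletion ℚ)) W 0),
        z ⟨x, localLayerPointsOfEmb_le_localTowerPointsOfEmb κ _ W 0 hx⟩ = 0)
    (S : Finset (HeightOneSpectrum (𝓞 ℚ))) (hSp : ∀ w ∈ S, (p : 𝓞 ℚ) ∉ w.asIdeal)
    (hS : ∀ w : HeightOneSpectrum (𝓞 ℚ), w ∉ S → (p : 𝓞 ℚ) ∉ w.asIdeal → W.HasGoodReductionAt w)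
    (hCas : ∀ (x : ∀ w : HeightOneSpectrum (𝓞 ℚ),
        discreteH1 (localSubgroup (⊤ : Subgroup (Field.absoluteGaloisGroup ℚ)) (w.adicCompletion ℚ))
          (localPoints W (w.adicCompletion ℚ)))
      (xi : ∀ w : InfinitePlace ℚ,
        discreteH1 (localSubgroup (⊤ : Subgroup (Field.absoluteGaloisGroup ℚ)) w.Completion)
          (localPoints W w.Completion)),
      (∀ w, ∃ k : ℕ, p ^ k • x w = 0) → (∀ w, ∃ k : ℕ, p ^ k • xi w = 0) →
      ∃ y : W.subgroupH1 p (⊤ : Subgroup (Field.absoluteGaloisGroup ℚ)),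
        y ∈ unramifiedOutside (⊤ : Subgroup (Field.absoluteGaloisGroup ℚ)) (W.geomPrimaryTorsion p) p
          (↑S : Set (HeightOneSpectrum (𝓞 ℚ))) ∧
        (∀ w, (w ∈ (↑S : Set (HeightOneSpectrum (𝓞 ℚ))) ∨ ((p : ℕ) : 𝓞 ℚ) ∈ w.asIdeal) →
          W.localResOver p ⊤ (w.adicCompletion ℚ) y = x w) ∧
        (∀ w, W.localResOver p ⊤ w.Completion y = xi w)) :
    ∀ k : (Π w : ↥S, ↥(W.localTowerKerPrimary κ (w.1.adicCompletion ℚ) 0)),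
      ∃ y ∈ (sharpFlatSelmerInfty W κ (closureEmb (K := ℚ) (v.adicCompletion ℚ)) ap g c col).comap
          (W.layerToInfty κ 0),
        ∀ w : ↥S, W.localResOver p (κ.layerSubgroup 0) (w.1.adicCompletion ℚ) y = (k w : _) := by
  intro k
  -- transports between the local groups of `⊤` and of the `0`-th layer (equal subgroups)
  have hle : ∀ w : HeightOneSpectrum (𝓞 ℚ),
      localSubgroup (⊤ : Subgroup (Field.absoluteGaloisGroup ℚ)) (w.adicCompletion ℚ) ≤
        localSubgroup (κ.layerSubgroup 0) (w.adicCompletion ℚ) := fun w ↦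
    localSubgroup_top_le_layer_zero κ (w.adicCompletion ℚ)
  have hge : ∀ w : HeightOneSpectrum (𝓞 ℚ),
      localSubgroup (κ.layerSubgroup 0) (w.adicCompletion ℚ) ≤
        localSubgroup (⊤ : Subgroup (Field.absoluteGaloisGroup ℚ)) (w.adicCompletion ℚ) := fun w ↦
    Subgroup.comap_mono le_top
  -- the family to prescribe: `k_w` (moved to level `Γ_ℚ`) on `S`, `0` elsewhere; `0` at `∞`
  let x : ∀ w : HeightOneSpectrum (𝓞 ℚ),
      discreteH1 (localSubgroup (⊤ : Subgroup (Field.absoluteGaloisGroup ℚ)) (w.adicCompletion ℚ))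
        (localPoints W (w.adicCompletion ℚ)) := fun w ↦
    if h : w ∈ S then
      Literature.NumberTheory.EllipticCurves.resOfLe (localPoints W (w.adicCompletion ℚ)) (hle w)
        ((k ⟨w, h⟩ : ↥(W.localTowerKerPrimary κ (w.adicCompletion ℚ) 0)) : _)
    else 0
  have hx_tor : ∀ w, ∃ n : ℕ, p ^ n • x w = 0 := fun w ↦ by
    by_cases h : w ∈ S
    · obtain ⟨n, hn⟩ := (k ⟨w, h⟩).2.2
      refine ⟨n, ?_⟩
      simp only [x, dif_pos h]
      rw [← map_nsmul, hn, map_zero]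
    · exact ⟨0, by simp only [x, dif_neg h, smul_zero]⟩
  obtain ⟨y, hyH, hyfin, hyinf⟩ := hCas x (fun _ ↦ 0) hx_tor (fun _ ↦ ⟨0, smul_zero _⟩)
  -- the class at layer `0`
  let y₀ : W.subgroupH1 p (κ.layerSubgroup 0) := W.resOfLe p (le_top : κ.layerSubgroup 0 ≤ ⊤) y
  -- its local classes
  have hloc0 : ∀ w : HeightOneSpectrum (𝓞 ℚ), W.localResOver p (κ.layerSubgroup 0) (w.adicCompletion ℚ) y₀ =
      Literature.NumberTheory.EllipticCurves.resOfLe (localPoints W (w.adicCompletion ℚ)) (hge w)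
        (W.localResOver p ⊤ (w.adicCompletion ℚ) y) := fun w ↦
    W.localResOverOfEmb_resOfLe p (closureEmb (K := ℚ) (w.adicCompletion ℚ))
      (le_top : κ.layerSubgroup 0 ≤ ⊤) y
  have hloc0inf : ∀ w : InfinitePlace ℚ, W.localResOver p (κ.layerSubgroup 0) w.Completion y₀ = 0 :=
    fun w ↦ by
    have h := W.localResOverOfEmb_resOfLe p (closureEmb (K := ℚ) w.Completion)
      (le_top : κ.layerSubgroup 0 ≤ ⊤) y
    have h0 : W.localResOverOfEmb p ⊤ (closureEmb (K := ℚ) w.Completion) y = 0 := hyinf w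
    exact h.trans ((congrArg _ h0).trans (map_zero _))
  have hkS : ∀ w : ↥S, W.localResOver p (κ.layerSubgroup 0) (w.1.adicCompletion ℚ) y₀ = (k w : _) := by
    intro w
    rw [hloc0 w.1, hyfin w.1 (Or.inl (Finset.mem_coe.mpr w.2))]
    simp only [x, dif_pos w.2]
    have e : (Literature.NumberTheory.EllipticCurves.resOfLe (localPoints W (w.1.adicCompletion ℚ)) (hge w.1)).comp
        (Literature.NumberTheory.EllipticCurves.resOfLe (localPoints W (w.1.adicCompletion ℚ)) (hle w.1)) =
        AddMonoidHom.id _ := by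
      rw [resOfLe_comp_holds (M := localPoints W (w.1.adicCompletion ℚ)) (hge w.1) (hle w.1)]
      exact resOfLe_refl_holds (M := localPoints W (w.1.adicCompletion ℚ)) _
    exact DFunLike.congr_fun e _
  have hkp : ∀ w : HeightOneSpectrum (𝓞 ℚ), (p : 𝓞 ℚ) ∈ w.asIdeal →
      W.localResOver p (κ.layerSubgroup 0) (w.adicCompletion ℚ) y₀ = 0 := fun w hw ↦ by
    have hwS : w ∉ S := fun h ↦ hSp w h hw
    rw [hloc0 w, hyfin w (Or.inr hw)]
    simp only [x, dif_neg hwS, map_zero]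
  refine ⟨y₀, ?_, hkS⟩
  -- `h_0 y₀ ∈ Sel^•(E/ℚ_∞)`
  rw [AddSubgroup.mem_comap]
  have hinv : ∀ σ : Field.absoluteGaloisGroup ℚ,
      W.conjH1 p κ.kerSubgroup σ (W.layerToInfty κ 0 y₀) = W.layerToInfty κ 0 y₀ :=
    fun σ ↦ conjH1_layerToInfty_zero W κ σ y₀
  -- unramified outside `Σ`
  have hy0H : y₀ ∈ unramifiedOutside (κ.layerSubgroup 0) (W.geomPrimaryTorsion p) p
      (↑S : Set (HeightOneSpectrum (𝓞 ℚ))) :=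
    resOfLe_mem_unramifiedOutside (W.geomPrimaryTorsion p) (le_top : κ.layerSubgroup 0 ≤ ⊤) p _ hyH
  have hhy0H : W.layerToInfty κ 0 y₀ ∈ unramifiedOutside κ.kerSubgroup (W.geomPrimaryTorsion p) p
      (↑S : Set (HeightOneSpectrum (𝓞 ℚ))) :=
    resOfLe_mem_unramifiedOutside (W.geomPrimaryTorsion p) (κ.kerSubgroup_le_layerSubgroup 0) p _ hy0H
  rw [mem_sharpFlatSelmerInfty_iff]
  refine ⟨(W.mem_selmerGroupOver_iff p κ.kerSubgroup _).mpr ⟨fun w σ ↦ ?_, fun w σ ↦ ?_⟩, fun σ ↦ ?_⟩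
  · rw [hinv σ]
    by_cases hpw : (p : 𝓞 ℚ) ∈ w.asIdeal
    · exact layerToInfty_mem_localKerOver_of_localResOver_eq_zero W κ y₀ (hkp w hpw)
    · by_cases hwS : w ∈ S
      · -- `loc_w(h_0 y₀) = r_w(k_w) = 0`
        rw [mem_localKerOver_iff]
        have h := W.localResOverOfEmb_resOfLe p (closureEmb (K := ℚ) (w.adicCompletion ℚ))
          (κ.kerSubgroup_le_layerSubgroup 0) y₀
        have h1 : W.localResOver p (κ.layerSubgroup 0) (w.adicCompletion ℚ) y₀ =
            ((k ⟨w, hwS⟩ : ↥(W.localTowerKerPrimary κ (w.adicCompletion ℚ) 0)) :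
              discreteH1 (localSubgroup (κ.layerSubgroup 0) (w.adicCompletion ℚ))
                (localPoints W (w.adicCompletion ℚ))) := hkS ⟨w, hwS⟩
        have h2 := ((W.mem_localTowerKerPrimary_iff κ (w.adicCompletion ℚ) 0 _).mp (k ⟨w, hwS⟩).2).1
        rw [W.mem_localTowerKer_iff] at h2
        exact h.trans ((congrArg _ h1).trans h2)
      · -- off `Σ`: unramified, hence Kummer over the cyclotomic tower
        have h1 : W.conjH1 p κ.kerSubgroup 1 (W.layerToInfty κ 0 y₀) ∈
            W.localKerOver p κ.kerSubgroup (w.adicCompletion ℚ) :=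
          GreenbergVatsalUnramifiedAway.unramKer_le_localKerOver_of_isCyclotomic (κ := κ) (v := w)
            (W := W) (p := p) hκ (hS w hwS hpw) hpw
            ((mem_unramifiedOutside_iff _).mp hhy0H w (fun h ↦ hwS (Finset.mem_coe.mp h)) hpw 1)
        rwa [W.conjH1_one_holds p κ.kerSubgroup, AddMonoidHom.id_apply] at h1
  · rw [hinv σ]
    exact layerToInfty_mem_localKerOver_of_localResOver_eq_zero W κ y₀ (hloc0inf w)
  · rw [hinv σ]
    exact layerToInfty_mem_sharpFlatLocalKummerOverOfEmb_of_mem_localKerOver W κ v h𝒦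
      ((W.mem_localKerOver_iff p (κ.layerSubgroup 0) (v.adicCompletion ℚ) y₀).mpr (hkp v hv))

/-- **CASSELS' COUNT from CASSELS.** `W/ℚ` elliptic, globally minimal, with GOOD reduction at `p`; `κ`
cyclotomic; the place `v ∋ p` with `•`-data such that «`Ker Col^•` kills `E(ℚ_p)`»; CASSELS at level `Γ_ℚ`
(displayed, body of `Greenberg1999.casselsSurjectivity_H1Sigma ℚ` read at `Σ₀ =` the bad places). Then
**`#(A^•_0/Sel_0) = p^{ord_p ∏_ℓ c_ℓ}`** — Greenberg's «by Cassels' theorem, `ker(g) = ker(r)`» (p. 104) with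
`|ker(r_ℓ)| = c_ℓ^{(p)}` (p. 88; tree), `ker(r_p) = 0` for the `•`-condition and nothing at `∞`.
[cite: GreenbergLNM1716, §4 p. 104 and Lemma 4.7; §3 Lemma 3.3 and p. 88] -/
theorem natCard_flatKerG_eq_pow_of_cassels [W.IsGloballyMinimal] (hκ : κ.IsCyclotomic)
    (hv : (p : 𝓞 ℚ) ∈ v.asIdeal) (hgood : W.HasGoodReductionAt v)
    (h𝒦 : ∀ z ∈ colemanKer κ (closureEmb (K := ℚ) (v.adicCompletion ℚ)) W ap g c col,
      ∀ (x : localPoints W (v.adicCompletion ℚ))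
        (hx : x ∈ localLayerPointsOfEmb κ (closureEmb (K := ℚ) (v.adicCompletion ℚ)) W 0),
        z ⟨x, localLayerPointsOfEmb_le_localTowerPointsOfEmb κ _ W 0 hx⟩ = 0)
    (hrp : ∀ y : W.subgroupH1 p (κ.layerSubgroup 0),
      W.layerToInfty κ 0 y ∈ sharpFlatLocalKummerOverOfEmb W p κ.kerSubgroup
          (closureEmb (K := ℚ) (v.adicCompletion ℚ))
          (localTowerPointsOfEmb κ (closureEmb (K := ℚ) (v.adicCompletion ℚ)) W)
          (colemanKer κ (closureEmb (K := ℚ) (v.adicCompletion ℚ)) W ap g c col) →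
        y ∈ W.localKerOver p (κ.layerSubgroup 0) (v.adicCompletion ℚ))
    (hCas : ∀ (S₀ : Set (HeightOneSpectrum (𝓞 ℚ))), S₀.Finite →
      (∀ w : HeightOneSpectrum (𝓞 ℚ), w ∉ S₀ → ((p : ℕ) : 𝓞 ℚ) ∉ w.asIdeal → W.HasGoodReductionAt w) →
      ∀ (x : ∀ w : HeightOneSpectrum (𝓞 ℚ),
        discreteH1 (localSubgroup (⊤ : Subgroup (Field.absoluteGaloisGroup ℚ)) (w.adicCompletion ℚ))
          (localPoints W (w.adicCompletion ℚ)))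
      (xi : ∀ w : InfinitePlace ℚ,
        discreteH1 (localSubgroup (⊤ : Subgroup (Field.absoluteGaloisGroup ℚ)) w.Completion)
          (localPoints W w.Completion)),
      (∀ w, ∃ k : ℕ, p ^ k • x w = 0) → (∀ w, ∃ k : ℕ, p ^ k • xi w = 0) →
      ∃ y : W.subgroupH1 p (⊤ : Subgroup (Field.absoluteGaloisGroup ℚ)),
        y ∈ unramifiedOutside (⊤ : Subgroup (Field.absoluteGaloisGroup ℚ)) (W.geomPrimaryTorsion p) p S₀ ∧
        (∀ w, (w ∈ S₀ ∨ ((p : ℕ) : 𝓞 ℚ) ∈ w.asIdeal) → W.localResOver p ⊤ (w.adicCompletion ℚ) y = x w) ∧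
        (∀ w, W.localResOver p ⊤ w.Completion y = xi w)) :
    Nat.card (↥((sharpFlatSelmerInfty W κ (closureEmb (K := ℚ) (v.adicCompletion ℚ)) ap g c col).comap
        (W.layerToInfty κ 0)) ⧸
      (W.selmerLayer κ 0).addSubgroupOf
        ((sharpFlatSelmerInfty W κ (closureEmb (K := ℚ) (v.adicCompletion ℚ)) ap g c col).comap
          (W.layerToInfty κ 0))) =
      p ^ padicValNat p W.tamagawaProduct := by
  -- `S` = the bad places (none of them above `p`, since `p` is good)
  have hbad : (W.badPlaces (𝓞 ℚ)).Finite := W.finite_badPlaces_holds (𝓞 ℚ)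
  let S : Finset (HeightOneSpectrum (𝓞 ℚ)) := hbad.toFinset
  have hSmem : ∀ w : HeightOneSpectrum (𝓞 ℚ), w ∈ S ↔ ¬ W.HasGoodReductionAt w := fun w ↦ by
    simp only [S, Set.Finite.mem_toFinset, WeierstrassCurve.badPlaces, Set.mem_setOf_eq]
  have hv' : ∀ w : HeightOneSpectrum (𝓞 ℚ), (p : 𝓞 ℚ) ∈ w.asIdeal → w = v := fun w hw ↦
    Literature.NumberTheory.GaloisRepresentations.LocalField.heightOneSpectrum_rat_eq_of_natCast_mem p w v
      hw hv
  have hSp : ∀ w ∈ S, (p : 𝓞 ℚ) ∉ w.asIdeal := fun w hw hpw ↦ by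
    rw [hv' w hpw] at hw
    exact (hSmem v).mp hw hgood
  have hS : ∀ w : HeightOneSpectrum (𝓞 ℚ), w ∉ S → (p : 𝓞 ℚ) ∉ w.asIdeal → W.HasGoodReductionAt w := by
    intro w hw _
    by_contra hng
    exact hw ((hSmem w).mpr hng)
  -- §1 with the surjectivity supplied by CASSELS
  have hcount := natCard_quotient_selmerLayer_zero_eq_prod_of_forall_exists W κ _
    (comap_layerToInfty_sharpFlatSelmerInfty_le_selmerInftyPreimage W κ
      (closureEmb (K := ℚ) (v.adicCompletion ℚ)) ap g c col)
    (fun w hw y hy ↦ by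
      rw [hv' w hw]
      have h1 := ((mem_sharpFlatSelmerInfty_iff W κ (closureEmb (K := ℚ) (v.adicCompletion ℚ))
        ap g c col _).mp (AddSubgroup.mem_comap.mp hy)).2 1
      rw [W.conjH1_one_holds p κ.kerSubgroup, AddMonoidHom.id_apply] at h1
      exact (W.mem_localKerOver_iff p (κ.layerSubgroup 0) (v.adicCompletion ℚ) y).mp (hrp y h1))
    S hS
    (forall_exists_mem_flatPreimage_localResOver_eq_of_cassels W κ ap g c col hκ hv h𝒦 S hSp hS
      (hCas (↑S) (Finset.finite_toSet S) (fun w hw hpw ↦ hS w (fun h ↦ hw (Finset.mem_coe.mpr h)) hpw)))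
  rw [hcount]
  -- `∏_{w ∈ S} #𝒦_{w,0}[p^∞] = p^{∑ ord_p c_w} = p^{ord_p ∏_w c_w}` (Greenberg p. 88; good places contribute 1)
  have h2 : ∏ w ∈ S, Nat.card (W.localTowerKerPrimary κ (w.adicCompletion ℚ) 0) =
      ∏ w ∈ S, p ^ padicValNat p
        ((W.baseChange (w.adicCompletion ℚ)).localTamagawaNumber (w.adicCompletionIntegers ℚ)) :=
    Finset.prod_congr rfl fun w hw ↦
      Summit.BirchSwinnertonDyer.Rank1Residual.Additive.natCard_localTowerKerPrimary_zero_eq_pow_of_isCyclotomic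
        W hκ (hSp w hw)
  have hsupp : (Function.mulSupport fun w : HeightOneSpectrum (𝓞 ℚ) ↦
      (W.baseChange (w.adicCompletion ℚ)).localTamagawaNumber (w.adicCompletionIntegers ℚ)) ⊆ ↑S := by
    intro w hw
    rw [Finset.mem_coe, hSmem]
    intro hgw
    exact hw (W.localTamagawaNumber_eq_one_of_hasGoodReductionAt_holds w hgw)
  have h4 : ∏ w ∈ S, (W.baseChange (w.adicCompletion ℚ)).localTamagawaNumber (w.adicCompletionIntegers ℚ) =
      W.tamagawaProduct := by
    rw [WeierstrassCurve.tamagawaProduct, finprod_eq_prod_of_mulSupport_subset _ hsupp]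
  have hne : ∀ w ∈ S, (W.baseChange (w.adicCompletion ℚ)).localTamagawaNumber (w.adicCompletionIntegers ℚ) ≠ 0 := by
    intro w _ h0
    have := W.tamagawaProduct_pos'
    rw [← h4, Finset.prod_eq_zero ‹w ∈ S› h0] at this
    exact lt_irrefl 0 this
  rw [h2, Finset.prod_pow_eq_pow_sum, ← h4, padicValNat_finset_prod S _ hne]

/-! ## §3 CASSELS by name: `Greenberg1999.casselsSurjectivity_H1Sigma ℚ` -/

/-- **CASSELS' COUNT `#(A^•_0/Sel_0) = p^{ord_p ∏_ℓ c_ℓ}` with Cassels' theorem supplied BY NAME** from the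
Literature fact `Greenberg1999.casselsSurjectivity_H1Sigma ℚ` (LNM 1716 Prop. 4.13 / p. 122) under its
printed hypotheses — `Sel_{p^∞}(E/ℚ)` finite and `E(ℚ)[p^∞] = 0` — for `W/ℚ` globally minimal with good
reduction at `p`, `κ` cyclotomic, `•`-data at `v ∋ p` with «`Ker Col^•` kills `E(ℚ_p)`» and "`r_p` injective"
(the K3 shapes). This is the EQUALITY that GEN 11's part 2 displayed as CASSELS♭@0.
[cite: GreenbergLNM1716, §4 p. 104 («by Cassels' theorem, ker(g) = ker(r)»), Prop. 4.13 and p. 122; §3 p. 88] -/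
theorem natCard_flatKerG_eq_pow_of_casselsSurjectivity [W.IsGloballyMinimal]
    (hC : Greenberg1999.casselsSurjectivity_H1Sigma ℚ) (hκ : κ.IsCyclotomic)
    (hv : (p : 𝓞 ℚ) ∈ v.asIdeal) (hgood : W.HasGoodReductionAt v)
    (h𝒦 : ∀ z ∈ colemanKer κ (closureEmb (K := ℚ) (v.adicCompletion ℚ)) W ap g c col,
      ∀ (x : localPoints W (v.adicCompletion ℚ))
        (hx : x ∈ localLayerPointsOfEmb κ (closureEmb (K := ℚ) (v.adicCompletion ℚ)) W 0),
        z ⟨x, localLayerPointsOfEmb_le_localTowerPointsOfEmb κ _ W 0 hx⟩ = 0)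
    (hrp : ∀ y : W.subgroupH1 p (κ.layerSubgroup 0),
      W.layerToInfty κ 0 y ∈ sharpFlatLocalKummerOverOfEmb W p κ.kerSubgroup
          (closureEmb (K := ℚ) (v.adicCompletion ℚ))
          (localTowerPointsOfEmb κ (closureEmb (K := ℚ) (v.adicCompletion ℚ)) W)
          (colemanKer κ (closureEmb (K := ℚ) (v.adicCompletion ℚ)) W ap g c col) →
        y ∈ W.localKerOver p (κ.layerSubgroup 0) (v.adicCompletion ℚ))
    (hSel : Finite (W.selmerGroupPInfty p))
    (hE : Nat.card (MulAction.fixedPoints (Field.absoluteGaloisGroup ℚ) (W.geomPrimaryTorsion p)) = 1) :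
    Nat.card (↥((sharpFlatSelmerInfty W κ (closureEmb (K := ℚ) (v.adicCompletion ℚ)) ap g c col).comap
        (W.layerToInfty κ 0)) ⧸
      (W.selmerLayer κ 0).addSubgroupOf
        ((sharpFlatSelmerInfty W κ (closureEmb (K := ℚ) (v.adicCompletion ℚ)) ap g c col).comap
          (W.layerToInfty κ 0))) =
      p ^ padicValNat p W.tamagawaProduct :=
  natCard_flatKerG_eq_pow_of_cassels W κ ap g c col hκ hv hgood h𝒦 hrp
    (fun S₀ hS₀ hgood' x xi hx hxi ↦ hC W p hSel hE S₀ hS₀ hgood' x xi hx hxi)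

end Rat

end Summit.BirchSwinnertonDyer.BirchSwinnertonDyer.Theorems.SSFlatEC

end
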